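import Summits.BirchSwinnertonDyer.BirchSwinnertonDyer.Theses.AdditiveBranchIMC
import Summits.BirchSwinnertonDyer.BirchSwinnertonDyer.Theorems.AdditiveBranchIMCInputs
import HarnessLib

/-!
# Route `AdditiveBranchIMC` (rung K1, cell `bsd-addord`): the `Assembly` item PROVED

Item `stmt-BirchSwinnertonDyer-19364` of route `route-BirchSwinnertonDyer-AdditiveBranchIMC`
(`Theses/AdditiveBranchIMC.lean`, assembly, rank 1): `PrintedFacts → ReadingFacts →
X3CaseOneRankZero → GordTwoRankZeroOffCaseOne → GordTwoRankOne → MultLower → GordHigherLower →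
AdditiveOrdinaryLowerHalf`.  Pure bookkeeping over the six-cell partition of the K1 locus
(`N10.locus_iff_cells`, `r ≤ 1 ↔ r = 0 ∨ r = 1`, Case-1 member or not): the proof is the landed
bridge `AdditiveBranchIMCInputs.additiveOrdinaryLowerHalf_of_inputs` (p408203) applied to the
Case-1 item instantiated at the two fact conjunctions.  Nothing is asserted: every open crux stays a
hypothesis of the item.

References: Miller, LMS J. Comput. Math. 14 (2011) Def. 1.1 [Miller2011LMS]; Delbourgo, Compositio
Math. 113 (1998), Main Conjecture p. 151 [Delbourgo1998].
-/

set_option autoImplicit false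
set_option linter.dupNamespace false

namespace Summit.BirchSwinnertonDyer.BirchSwinnertonDyer.Theorems

/-- **Item `Assembly` of route `AdditiveBranchIMC` holds**: the five cell statements (Case-1 rank-0
rows from the facts, no-Case-1 rank-0 rows, rank-1 rows of (G-ord, `e = 2`), cell (M), cell (G-ord,
`e ∈ {3,4,6}`)) assemble to the leaf `AdditiveOrdinaryLowerHalf` by
`AdditiveBranchIMCInputs.additiveOrdinaryLowerHalf_of_inputs`. [cite: Miller2011LMS, Def. 1.1]
[cite: Delbourgo1998, Main Conjecture (p. 151) (shape only; nothing asserted)] -/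
theorem additiveBranchIMC_assembly_proof :
    Summit.BirchSwinnertonDyer.BirchSwinnertonDyer.Theses.AdditiveBranchIMC.Assembly := by
  unfold Summit.BirchSwinnertonDyer.BirchSwinnertonDyer.Theses.AdditiveBranchIMC.Assembly
    Summit.BirchSwinnertonDyer.BirchSwinnertonDyer.Theses.AdditiveBranchIMC.X3CaseOneRankZero
    Summit.BirchSwinnertonDyer.BirchSwinnertonDyer.Theses.AdditiveBranchIMC.GordTwoRankZeroOffCaseOne
    Summit.BirchSwinnertonDyer.BirchSwinnertonDyer.Theses.AdditiveBranchIMC.GordTwoRankOne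
    Summit.BirchSwinnertonDyer.BirchSwinnertonDyer.Theses.AdditiveBranchIMC.MultLower
    Summit.BirchSwinnertonDyer.BirchSwinnertonDyer.Theses.AdditiveBranchIMC.GordHigherLower
  intro hP hR h1 h2 h3 h4 h5
  exact AdditiveBranchIMCInputs.additiveOrdinaryLowerHalf_of_inputs (h1 hP hR) h2 h3 h4 h5

end Summit.BirchSwinnertonDyer.BirchSwinnertonDyer.Theorems
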